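import Summits.QuantumFields.YangMills.Theorems.FlatTubeReductionRateSchedule
import Summits.QuantumFields.YangMills.Theorems.FlatTubeReductionRecordWindowSixth
import HarnessLib

/-!
# The RELATIVE RATE of the dressed kernel comparison is `O(λ_b²)`: along the schedule (`t = R = x = β^{-1/2}`, `T = 9L·R₁ + ε ≤ 46Lxℓ`, `βT² ≤ 2116L²ℓ²`, `Γ = ε|Site|`, `βΓ = |Site|`,
# `σ = 12L³δ⁴`, `√σ ≤ 4L²δ²`, near/far threshold `α ≤ A·x·ℓ`, which covers the rate twin's `A·x·√ℓ`) the symmetric rate `η_s ≤ C₁δ² + C₂xℓ³` and `κ₀ = β|E|α²(6t+2T)² + 120η_s² ≤ K₁δ⁴ + K₂x²ℓ⁶`; at the rate window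
# `δ = D·recordDelta1 L (1/6)` this is `≤ a·λ_b(L³β)²` eventually (route `FlatTubeReduction`, crux K1 `NearFlatRatioLaw` stmt-QuantumFields-24720; seat `ym-line-ftr-p1` g15; rate twin
# «ratepack-v3 / frozen fibres»; R2b1 RECORD rung — no summit statement is proved here)

WHY (memo `Cruxes/NearFlatRatioLaw/Lines/ratepack-v3-frozen-g12.md` §9; NOTES T6b).  `κ₀` of `…DressedFixedBeta.dressed_fixed_beta_estimate` is the relative rate of the (B-T) comparison at the
`β^{-1/6}` window; `AnalyticRatePotInput.hκ_small` wants `κ ≤ a·λ_b(L³β)²`.  The dominant term is the log-free magnetic one, `1728·N_P·√σ ≍ δ² ≍ β^{-1/3}` (fibre radius `t = β^{-1/2}` WITHOUT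
log — the reason for the split radii of `…SymmetricCorePair`); everything else is `O(β^{-1/2}·polylog)`.  The near/far threshold is taken `α ≤ A·β^{-1/2}√ℓ` (NOT lane A's `β^{-1/2}ℓ`: the
off-diagonal tail factor `e^{3Bα²}` must stay polynomial, `B = L³β`).
* `symEta_le_atom` — `η_s ≤ C₁δ² + C₂xℓ³`; `symKappa_le_atom` — `κ₀ ≤ K₁δ⁴ + K₂x²ℓ⁶`;
* ★★ `eventually_symKappa_le_bareLambda_sq` — at `δ = D·recordDelta1 L (1/6)`, `x = powScale(1/2)`, `ℓ = btLog`: `κ₀ ≤ a·λ_b(L³β)²` eventually (`δ⁴ = (14D/|Site|)⁴·β^{-2/3}`, `x²ℓ⁶ ≤ δ⁴`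
  eventually, `β^{-2/3} = (L²/2^{2/3})λ_b(L³β)²` via `sq_scaledDelta1_eq`).
HONEST FRAMING: real-analysis bookkeeping for a stub of the CONDITIONAL reduction route R2b1; femto rung R2b1 (RECORD label); not infinite volume, not a gap, not Clay.  No defs, no named facts,
no `sorry`.
-/

set_option autoImplicit false

noncomputable section

open MeasureTheory Filter Topology Real
open scoped BigOperators
open Literature.MathematicalPhysics.QuantumFieldTheory
open Literature.MathematicalPhysics.QuantumLattice

namespace Summit.QuantumFields.YangMills.Theorems.FemtoTransferGap.TwoLattice.ConstTube

open Summit.QuantumFields.YangMills.Theorems.FemtoTransferGap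
open Summit.QuantumFields.YangMills.Theorems.FemtoTransferGap.TwoLattice
open Summit.QuantumFields.YangMills.Theorems.FemtoTransferGap.TwoLattice.Avg
open Summit.QuantumFields.YangMills.Theorems.FemtoTransferGap.TwoLattice.Cov

variable {L : ℕ} [NeZero L]

/-! ## §1 The atoms -/

/-- ★ **Envelope of the symmetric rate**: `η_s ≤ C₁·δ² + C₂·xℓ³` (with `t = R = x`, `βx² = 1`, `βT² ≤ A_Tℓ²`, `βΓ ≤ N`, `σ ≤ 12L³δ²`, `√σ ≤ 4L²δ²`, `α ≤ A·x·ℓ`, `xℓ ≤ 1`, `x ≤ 1 ≤ ℓ`,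
`δ ≤ 1`). [folklore] -/
theorem symEta_le_atom {β δ α T x Γ σ ℓ AT A N : ℝ} (hβ : 0 ≤ β) (hδ1 : δ ≤ 1) (hℓ : 1 ≤ ℓ) (hx0 : 0 ≤ x) (hx1 : x ≤ 1) (hxℓ : x * ℓ ≤ 1) (hβx : β * x ^ 2 = 1)
    (hT2 : β * T ^ 2 ≤ AT * ℓ ^ 2) (hAT : 0 ≤ AT) (hA : 0 ≤ A) (hα0 : 0 ≤ α) (hα : α ≤ A * x * ℓ)
    (hσδ : σ ≤ 12 * (L : ℝ) ^ 3 * δ ^ 2) (hsσ : Real.sqrt σ ≤ 4 * (L : ℝ) ^ 2 * δ ^ 2) (hΓ0 : 0 ≤ Γ) (hΓ : β * Γ ≤ N) (hN : 0 ≤ N) :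
    β * ((Fintype.card (Edge 3 L) : ℝ) * (558 * α ^ 2 * T ^ 2 + 192 * α * T ^ 2) + 216 * α * δ * Γ) +
        β / 2 * (100 * σ * (Fintype.card (Plaquette 3 L × Fin 3) : ℝ) * x ^ 2 + 2 * stepActionErr (L := L) x σ + 10080 * α * (Fintype.card (Plaquette 3 L × Fin 3) : ℝ) * x ^ 2) ≤
      (600 * (Fintype.card (Plaquette 3 L × Fin 3) : ℝ) * (L : ℝ) ^ 3 + 6912 * (Fintype.card (Plaquette 3 L) : ℝ) * (L : ℝ) ^ 2) * δ ^ 2 +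
        ((Fintype.card (Edge 3 L) : ℝ) * (558 * A ^ 2 * AT + 192 * A * AT) + 216 * A * N + (Fintype.card (Plaquette 3 L) : ℝ) * (29376 + 700569) +
          5040 * A * (Fintype.card (Plaquette 3 L × Fin 3) : ℝ)) * (x * ℓ ^ 3) := by
  obtain ⟨E, hEdef⟩ : ∃ E : ℝ, E = (Fintype.card (Edge 3 L) : ℝ) := ⟨_, rfl⟩
  obtain ⟨NP, hNPdef⟩ : ∃ NP : ℝ, NP = (Fintype.card (Plaquette 3 L × Fin 3) : ℝ) := ⟨_, rfl⟩
  obtain ⟨Npl, hNpldef⟩ : ∃ Npl : ℝ, Npl = (Fintype.card (Plaquette 3 L) : ℝ) := ⟨_, rfl⟩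
  have hstep : stepActionErr (L := L) x σ = Npl * (1728 * x ^ 2 * Real.sqrt σ + 29376 * x ^ 3 + 700569 * x ^ 4) := by
    rw [hNpldef]; rfl
  rw [hstep, ← hEdef, ← hNPdef, ← hNpldef]
  have hE : 0 ≤ E := by rw [hEdef]; exact Nat.cast_nonneg _
  have hNP : 0 ≤ NP := by rw [hNPdef]; exact Nat.cast_nonneg _
  have hNpl : 0 ≤ Npl := by rw [hNpldef]; exact Nat.cast_nonneg _
  have hℓ0 : 0 ≤ ℓ := by linarith
  have hxℓ0 : 0 ≤ x * ℓ := by positivity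
  have hxℓ3 : 0 ≤ x * ℓ ^ 3 := by positivity
  -- `xℓ ≤ xℓ³`, `x ≤ xℓ³`, `x²ℓ⁴ ≤ xℓ³`, `x² ≤ x`
  have hx_xl3 : x ≤ x * ℓ ^ 3 := le_mul_of_one_le_right hx0 (one_le_pow₀ hℓ)
  have hxl_xl3 : x * ℓ ≤ x * ℓ ^ 3 := mul_le_mul_of_nonneg_left (le_self_pow₀ hℓ (by norm_num)) hx0
  have hx2l4 : x ^ 2 * ℓ ^ 4 ≤ x * ℓ ^ 3 := by
    have : x ^ 2 * ℓ ^ 4 = (x * ℓ) * (x * ℓ ^ 3) := by ring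
    rw [this]; exact mul_le_of_le_one_left hxℓ3 hxℓ
  have hx2 : x ^ 2 ≤ x := by
    calc x ^ 2 = x * x := sq x
      _ ≤ 1 * x := mul_le_mul_of_nonneg_right hx1 hx0
      _ = x := one_mul x
  -- kinetic terms
  have hα2 : α ^ 2 ≤ (A * x * ℓ) ^ 2 := pow_le_pow_left₀ hα0 hα 2
  have k1 : β * (558 * α ^ 2 * T ^ 2) ≤ 558 * A ^ 2 * AT * (x * ℓ ^ 3) := by
    have h2 : α ^ 2 * (β * T ^ 2) ≤ (A * x * ℓ) ^ 2 * (AT * ℓ ^ 2) := mul_le_mul hα2 hT2 (by positivity) (by positivity)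
    have h3 : (A * x * ℓ) ^ 2 * (AT * ℓ ^ 2) = A ^ 2 * AT * (x ^ 2 * ℓ ^ 4) := by ring
    have h4 : A ^ 2 * AT * (x ^ 2 * ℓ ^ 4) ≤ A ^ 2 * AT * (x * ℓ ^ 3) := mul_le_mul_of_nonneg_left hx2l4 (by positivity)
    have e : β * (558 * α ^ 2 * T ^ 2) = 558 * (α ^ 2 * (β * T ^ 2)) := by ring
    rw [e]; rw [h3] at h2; linarith [h2, h4]
  have k2 : β * (192 * α * T ^ 2) ≤ 192 * A * AT * (x * ℓ ^ 3) := by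
    have h2 : α * (β * T ^ 2) ≤ (A * x * ℓ) * (AT * ℓ ^ 2) := mul_le_mul hα hT2 (by positivity) (by positivity)
    have h3 : (A * x * ℓ) * (AT * ℓ ^ 2) = A * AT * (x * ℓ ^ 3) := by ring
    have e : β * (192 * α * T ^ 2) = 192 * (α * (β * T ^ 2)) := by ring
    rw [e]; rw [h3] at h2; linarith [h2]
  have k3 : β * (216 * α * δ * Γ) ≤ 216 * A * N * (x * ℓ ^ 3) := by
    have h1 : α * δ ≤ A * x * ℓ := (mul_le_of_le_one_right hα0 hδ1).trans hα
    have h2 : α * δ * (β * Γ) ≤ (A * x * ℓ) * N := mul_le_mul h1 hΓ (by positivity) (by positivity)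
    have h3 : A * N * (x * ℓ) ≤ A * N * (x * ℓ ^ 3) := mul_le_mul_of_nonneg_left hxl_xl3 (by positivity)
    have e : β * (216 * α * δ * Γ) = 216 * (α * δ * (β * Γ)) := by ring
    have e' : (A * x * ℓ) * N = A * N * (x * ℓ) := by ring
    rw [e]; rw [e'] at h2; linarith [h2, h3]
  -- magnetic terms
  have m1 : β / 2 * (100 * σ * NP * x ^ 2) ≤ 600 * NP * (L : ℝ) ^ 3 * δ ^ 2 := by
    have h1 : β / 2 * (100 * σ * NP * x ^ 2) = 50 * (NP * σ) * (β * x ^ 2) := by ring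
    rw [h1, hβx, mul_one]
    have h2 : NP * σ ≤ NP * (12 * (L : ℝ) ^ 3 * δ ^ 2) := mul_le_mul_of_nonneg_left hσδ hNP
    linarith [h2]
  have m2 : β / 2 * (2 * (Npl * (1728 * x ^ 2 * Real.sqrt σ + 29376 * x ^ 3 + 700569 * x ^ 4))) ≤
      6912 * Npl * (L : ℝ) ^ 2 * δ ^ 2 + Npl * (29376 + 700569) * (x * ℓ ^ 3) := by
    have e1 : β / 2 * (2 * (Npl * (1728 * x ^ 2 * Real.sqrt σ + 29376 * x ^ 3 + 700569 * x ^ 4))) =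
        Npl * (1728 * Real.sqrt σ + 29376 * x + 700569 * x ^ 2) * (β * x ^ 2) := by ring
    rw [e1, hβx, mul_one]
    have a1 : 1728 * Real.sqrt σ ≤ 6912 * (L : ℝ) ^ 2 * δ ^ 2 := by linarith [hsσ]
    have a2 : 29376 * x ≤ 29376 * (x * ℓ ^ 3) := by linarith [hx_xl3]
    have a3 : 700569 * x ^ 2 ≤ 700569 * (x * ℓ ^ 3) := by linarith [hx2, hx_xl3]
    have h := mul_le_mul_of_nonneg_left (add_le_add (add_le_add a1 a2) a3) hNpl
    linarith [h]
  have m3 : β / 2 * (10080 * α * NP * x ^ 2) ≤ 5040 * A * NP * (x * ℓ ^ 3) := by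
    have h1 : β / 2 * (10080 * α * NP * x ^ 2) = 5040 * (NP * α) * (β * x ^ 2) := by ring
    rw [h1, hβx, mul_one]
    have h2 : α ≤ A * (x * ℓ ^ 3) := hα.trans ((le_of_eq (mul_assoc _ _ _)).trans (mul_le_mul_of_nonneg_left hxl_xl3 hA))
    have h3 : NP * α ≤ NP * (A * (x * ℓ ^ 3)) := mul_le_mul_of_nonneg_left h2 hNP
    linarith [h3]
  have esplit : β * (E * (558 * α ^ 2 * T ^ 2 + 192 * α * T ^ 2) + 216 * α * δ * Γ) +
      β / 2 * (100 * σ * NP * x ^ 2 + 2 * (Npl * (1728 * x ^ 2 * Real.sqrt σ + 29376 * x ^ 3 + 700569 * x ^ 4)) + 10080 * α * NP * x ^ 2) =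
      E * (β * (558 * α ^ 2 * T ^ 2) + β * (192 * α * T ^ 2)) + β * (216 * α * δ * Γ) +
        (β / 2 * (100 * σ * NP * x ^ 2) + β / 2 * (2 * (Npl * (1728 * x ^ 2 * Real.sqrt σ + 29376 * x ^ 3 + 700569 * x ^ 4))) +
          β / 2 * (10080 * α * NP * x ^ 2)) := by ring
  rw [esplit]
  have hk : E * (β * (558 * α ^ 2 * T ^ 2) + β * (192 * α * T ^ 2)) ≤ E * (558 * A ^ 2 * AT * (x * ℓ ^ 3) + 192 * A * AT * (x * ℓ ^ 3)) :=
    mul_le_mul_of_nonneg_left (add_le_add k1 k2) hE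
  linarith [hk, k3, m1, m2, m3]

/-- ★ **Envelope of the relative rate**: `κ₀ = β|E|α²(6x+2T)² + 120η_s² ≤ K₁δ⁴ + K₂x²ℓ⁶` given `η_s ≤ C₁δ² + C₂xℓ³`, `T ≤ 46Lxℓ`. [folklore] -/
theorem symKappa_le_atom {β δ α T x ℓ A ηs C₁ C₂ : ℝ} (hβ : 0 ≤ β) (hℓ : 1 ≤ ℓ) (hx0 : 0 ≤ x) (hβx : β * x ^ 2 = 1) (hT0 : 0 ≤ T) (hTx : T ≤ 46 * L * x * ℓ)
    (hα0 : 0 ≤ α) (hα : α ≤ A * x * ℓ) (hηs0 : 0 ≤ ηs) (hηs : ηs ≤ C₁ * δ ^ 2 + C₂ * (x * ℓ ^ 3)) :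
    β * (Fintype.card (Edge 3 L) : ℝ) * α ^ 2 * (6 * x + 2 * T) ^ 2 + 120 * ηs ^ 2 ≤
      (240 * C₁ ^ 2) * δ ^ 4 + (9604 * (Fintype.card (Edge 3 L) : ℝ) * (L : ℝ) ^ 2 * A ^ 2 + 240 * C₂ ^ 2) * (x ^ 2 * ℓ ^ 6) := by
  set E := (Fintype.card (Edge 3 L) : ℝ)
  have hE : 0 ≤ E := Nat.cast_nonneg _
  have hL1 : (1 : ℝ) ≤ L := by exact_mod_cast NeZero.one_le
  have hℓ0 : 0 ≤ ℓ := by linarith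
  -- first term
  have h6 : 6 * x + 2 * T ≤ 98 * L * x * ℓ := by
    have h1 : x ≤ L * x * ℓ := by
      calc x = 1 * x * 1 := by ring
        _ ≤ L * x * ℓ := mul_le_mul (mul_le_mul_of_nonneg_right hL1 hx0) hℓ zero_le_one (by positivity)
    nlinarith
  have hsq : (6 * x + 2 * T) ^ 2 ≤ (98 * L * x * ℓ) ^ 2 := pow_le_pow_left₀ (by positivity) h6 2
  have hα2 : α ^ 2 ≤ (A * x * ℓ) ^ 2 := pow_le_pow_left₀ hα0 hα 2
  have f1 : β * E * α ^ 2 * (6 * x + 2 * T) ^ 2 ≤ 9604 * E * (L : ℝ) ^ 2 * A ^ 2 * (x ^ 2 * ℓ ^ 6) := by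
    have h1 : β * E * α ^ 2 * (6 * x + 2 * T) ^ 2 ≤ β * E * (A * x * ℓ) ^ 2 * (98 * L * x * ℓ) ^ 2 :=
      mul_le_mul (mul_le_mul_of_nonneg_left hα2 (by positivity)) hsq (by positivity) (by positivity)
    have h2 : β * E * (A * x * ℓ) ^ 2 * (98 * L * x * ℓ) ^ 2 = 9604 * E * (L : ℝ) ^ 2 * A ^ 2 * (x ^ 2 * ℓ ^ 4) * (β * x ^ 2) := by ring
    rw [h2, hβx, mul_one] at h1
    have h46 : x ^ 2 * ℓ ^ 4 ≤ x ^ 2 * ℓ ^ 6 := mul_le_mul_of_nonneg_left (pow_le_pow_right₀ hℓ (by norm_num)) (sq_nonneg x)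
    nlinarith [mul_le_mul_of_nonneg_left h46 (by positivity : 0 ≤ 9604 * E * (L : ℝ) ^ 2 * A ^ 2)]
  -- second term: `ηs² ≤ 2C₁²δ⁴ + 2C₂²x²ℓ⁶`
  have f2 : ηs ^ 2 ≤ 2 * C₁ ^ 2 * δ ^ 4 + 2 * C₂ ^ 2 * (x ^ 2 * ℓ ^ 6) := by
    have h1 : ηs ^ 2 ≤ (C₁ * δ ^ 2 + C₂ * (x * ℓ ^ 3)) ^ 2 := pow_le_pow_left₀ hηs0 hηs 2
    nlinarith [sq_nonneg (C₁ * δ ^ 2 - C₂ * (x * ℓ ^ 3))]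
  nlinarith [f1, f2]

/-- The symmetric rate `η_s` is nonnegative. [folklore] -/
theorem symEta_nonneg {β δ α T x Γ σ : ℝ} (hβ : 0 ≤ β) (hδ0 : 0 ≤ δ) (hx0 : 0 ≤ x) (hα0 : 0 ≤ α) (hσ0 : 0 ≤ σ) (hΓ0 : 0 ≤ Γ) :
    0 ≤ β * ((Fintype.card (Edge 3 L) : ℝ) * (558 * α ^ 2 * T ^ 2 + 192 * α * T ^ 2) + 216 * α * δ * Γ) +
        β / 2 * (100 * σ * (Fintype.card (Plaquette 3 L × Fin 3) : ℝ) * x ^ 2 + 2 * stepActionErr (L := L) x σ + 10080 * α * (Fintype.card (Plaquette 3 L × Fin 3) : ℝ) * x ^ 2) := by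
  have := stepActionErr_nonneg (L := L) (σ := σ) hx0
  positivity

/-! ## §2 ★★ Eventually along the schedule: `κ₀ ≤ a·λ_b(L³β)²` -/

/-- `x²ℓ⁶ ≤ δ⁴` at the rate window once `β^{-1/3}ℓ⁶ ≤ (14D/|Site|)⁴` (`x = powScale (1/2)`, `δ = D·recordDelta1 L (1/6)`, `β ≥ 1`). [folklore] -/
theorem powScale_half_sq_mul_log_pow_le_delta_four {D β : ℝ} (hβ1 : 1 ≤ β)
    (h : powScale (1 / 3) β * btLog β ^ 6 ≤ (14 * D / (Fintype.card (Site 3 L) : ℝ)) ^ 4) :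
    powScale (1 / 2) β ^ 2 * btLog β ^ 6 ≤ (D * recordDelta1 L (1 / 6) β) ^ 4 := by
  have hβ0 : 0 ≤ β := by linarith
  have hβpos : 0 < β := by linarith
  have e1 : powScale (1 / 2) β ^ 2 = powScale (2 / 3) β * powScale (1 / 3) β := by
    rw [powScale_eq hβ1, powScale_eq hβ1, powScale_eq hβ1, ← Real.rpow_mul_natCast hβ0, ← Real.rpow_add hβpos,
      show (-(1 / 2 : ℝ)) * ((2 : ℕ) : ℝ) = -(2 / 3 : ℝ) + -(1 / 3 : ℝ) by norm_num]
  have e16 : powScale (1 / 6) β ^ 4 = powScale (2 / 3) β := by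
    rw [powScale_eq hβ1, powScale_eq hβ1, ← Real.rpow_mul_natCast hβ0, show (-(1 / 6 : ℝ)) * ((4 : ℕ) : ℝ) = -(2 / 3 : ℝ) by norm_num]
  have e2 : (D * recordDelta1 L (1 / 6) β) ^ 4 = (14 * D / (Fintype.card (Site 3 L) : ℝ)) ^ 4 * powScale (2 / 3) β := by
    unfold recordDelta1
    rw [show D * (14 * powScale (1 / 6) β / (Fintype.card (Site 3 L) : ℝ)) = (14 * D / (Fintype.card (Site 3 L) : ℝ)) * powScale (1 / 6) β by ring, mul_pow, e16]
  rw [e1, e2, mul_assoc, mul_comm ((14 * D / (Fintype.card (Site 3 L) : ℝ)) ^ 4)]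
  exact mul_le_mul_of_nonneg_left h (powScale_pos _ _).le

/-- `δ⁴ = c_δ²·λ_b(L³β)²` at the rate window `δ = D·recordDelta1 L (1/6)` (`β ≥ 1`), from `RateTube.sq_scaledDelta1_eq`. [folklore] -/
theorem scaledDelta1_pow_four_eq (D : ℝ) {β : ℝ} (hβ1 : 1 ≤ β) :
    (D * recordDelta1 L (1 / 6) β) ^ 4 = ((14 * D / Fintype.card (Site 3 L)) ^ 2 * L / (2 : ℝ) ^ ((1 : ℝ) / 3)) ^ 2 * bareLambda ((L : ℝ) ^ 3 * β) ^ 2 := by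
  rw [show (D * recordDelta1 L (1 / 6) β) ^ 4 = ((D * recordDelta1 L (1 / 6) β) ^ 2) ^ 2 by ring, RateTube.sq_scaledDelta1_eq (L := L) D hβ1]; ring

/-- Final bookkeeping step: `240C₁²·δ⁴ + K₂·y ≤ (240C₁² + K₂)c_δ²·Λ²` when `y ≤ δ⁴ = c_δ²Λ²`, `K₂ ≥ 0`. [folklore] -/
theorem symKappa_final_step {C₁ K₂ cδ d4 y Λ : ℝ} (hK₂ : 0 ≤ K₂) (h1 : y ≤ d4) (h2 : d4 = cδ ^ 2 * Λ ^ 2) :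
    240 * C₁ ^ 2 * d4 + K₂ * y ≤ (240 * C₁ ^ 2 + K₂) * cδ ^ 2 * Λ ^ 2 := by
  have h3 := mul_le_mul_of_nonneg_left h1 hK₂
  subst h2
  nlinarith [h3, sq_nonneg C₁, sq_nonneg (cδ * Λ)]

/-- ★★ **The relative rate is `O(λ_b²)`**: for `D ≥ 1`, `A ≥ 0` and any threshold family `α` with `0 ≤ α β ≤ A·powScale(1/2)β·btLog β` eventually, along the schedule `δ = D·recordDelta1 L (1/6)`,
`t = R = powScale (1/2)`, `T = 9L·btR1 + btEps`, `Γ = btEps·|Site|`, `σ = 12L³δ⁴`, the relative rate `κ₀` of `dressed_fixed_beta_estimate` satisfies `κ₀(β) ≤ a·bareLambda(L³β)²` eventually,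
for an explicit `a = a(L, D, A)`. [folklore] -/
theorem eventually_symKappa_le_bareLambda_sq {D A : ℝ} (hD : 1 ≤ D) (hA : 0 ≤ A) {α : ℝ → ℝ} (hα0 : ∀ᶠ β : ℝ in atTop, 0 ≤ α β)
    (hα : ∀ᶠ β : ℝ in atTop, α β ≤ A * powScale (1 / 2) β * btLog β) :
    ∃ a : ℝ, ∀ᶠ β : ℝ in atTop,
      β * (Fintype.card (Edge 3 L) : ℝ) * α β ^ 2 * (6 * powScale (1 / 2) β + 2 * (9 * L * btR1 β + btEps β)) ^ 2 +
          120 * (β * ((Fintype.card (Edge 3 L) : ℝ) * (558 * α β ^ 2 * (9 * L * btR1 β + btEps β) ^ 2 + 192 * α β * (9 * L * btR1 β + btEps β) ^ 2) +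
              216 * α β * (D * recordDelta1 L (1 / 6) β) * (btEps β * Fintype.card (Site 3 L))) +
            β / 2 * (100 * ((L : ℝ) ^ 3 * (12 * (D * recordDelta1 L (1 / 6) β) ^ 4)) * (Fintype.card (Plaquette 3 L × Fin 3) : ℝ) * powScale (1 / 2) β ^ 2 +
              2 * stepActionErr (L := L) (powScale (1 / 2) β) ((L : ℝ) ^ 3 * (12 * (D * recordDelta1 L (1 / 6) β) ^ 4)) +
              10080 * α β * (Fintype.card (Plaquette 3 L × Fin 3) : ℝ) * powScale (1 / 2) β ^ 2)) ^ 2 ≤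
        a * bareLambda ((L : ℝ) ^ 3 * β) ^ 2 := by
  have hN : (0 : ℝ) < (Fintype.card (Site 3 L) : ℝ) := by exact_mod_cast Fintype.card_pos
  have hc40 : 0 < (14 * D / (Fintype.card (Site 3 L) : ℝ)) ^ 4 := by positivity
  -- the constant (in the expanded form the atoms produce)
  obtain ⟨a, ha⟩ : ∃ a : ℝ, a =
      (240 * (600 * (Fintype.card (Plaquette 3 L × Fin 3) : ℝ) * (L : ℝ) ^ 3 + 6912 * (Fintype.card (Plaquette 3 L) : ℝ) * (L : ℝ) ^ 2) ^ 2 +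
          (9604 * (Fintype.card (Edge 3 L) : ℝ) * (L : ℝ) ^ 2 * A ^ 2 +
            240 * ((Fintype.card (Edge 3 L) : ℝ) * (558 * A ^ 2 * (2116 * (L : ℝ) ^ 2) + 192 * A * (2116 * (L : ℝ) ^ 2)) + 216 * A * (Fintype.card (Site 3 L) : ℝ) +
              (Fintype.card (Plaquette 3 L) : ℝ) * (29376 + 700569) + 5040 * A * (Fintype.card (Plaquette 3 L × Fin 3) : ℝ)) ^ 2)) *
        ((14 * D / Fintype.card (Site 3 L)) ^ 2 * L / (2 : ℝ) ^ ((1 : ℝ) / 3)) ^ 2 := ⟨_, rfl⟩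
  refine ⟨a, ?_⟩
  have ht := (tendsto_powScale_mul_btLog_pow (show (0 : ℝ) < 1 / 3 by norm_num) 6).eventually (eventually_le_nhds hc40)
  filter_upwards [eventually_rate_schedule_facts₂ (L := L) hD, hα0, hα, ht] with β h hα0β hαβ hℓ6
  obtain ⟨hβ1, -, hℓ1, -, hδ0, -, hδ1, hx0, hx1, -, hT0, -, hTx, hT2, -, hσ0, -, hσδ, hsσ, hΓ, hxl, hxl1⟩ := h
  have hxℓ : powScale (1 / 2) β * btLog β ≤ 1 := by rw [← hxl]; exact hxl1
  have hβ0 : 0 ≤ β := by linarith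
  have hβx : β * powScale (1 / 2) β ^ 2 = 1 := mul_powScale_half_sq hβ1
  have hΓ0 : 0 ≤ btEps β * (Fintype.card (Site 3 L) : ℝ) := mul_nonneg (powScale_pos _ _).le hN.le
  have hAT : (0 : ℝ) ≤ 2116 * (L : ℝ) ^ 2 := by positivity
  have hη := symEta_le_atom (L := L) hβ0 hδ1 hℓ1 hx0 hx1 hxℓ hβx hT2 hAT hA hα0β hαβ hσδ hsσ hΓ0 hΓ.le hN.le
  have hη0 := symEta_nonneg (L := L) (T := 9 * L * btR1 β + btEps β) hβ0 hδ0 hx0 hα0β hσ0 hΓ0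
  have hκ := symKappa_le_atom (L := L) hβ0 hℓ1 hx0 hβx hT0 hTx hα0β hαβ hη0 hη
  rw [ha]
  exact hκ.trans (symKappa_final_step (by positivity) (powScale_half_sq_mul_log_pow_le_delta_four (L := L) hβ1 hℓ6) (scaledDelta1_pow_four_eq (L := L) D hβ1))

end Summit.QuantumFields.YangMills.Theorems.FemtoTransferGap.TwoLattice.ConstTube

end
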